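import Mathlib
import Summits.Ventures.HodgeRepro2.T5DyadicExamples

/-!
# T5CyclicSubfieldGalois — the subfields of a cyclic Galois extension are cyclic Galois;
`e·f·g` in the cubic subfield

Tier-5 support (seat p3) for sub-step N2 of `route/T5-N2-route-3.md`, §N2.8.2(a): «Gal(E/ℚ) is
CYCLIC of order 6 … so F⁺ is the cyclic cubic and K the unique quadratic subfield» and (b)/(e):
the arithmetic of a prime in the cyclic cubic `F⁺` («inert (g₂ = 1) or splits completely (g₂ = 3)»;
«p3's "or totally ramified" alternative does not occur» for `p = 2`).

`T5CyclicSubfields` (p393645) gave the UNIQUENESS of the intermediate field of each degree.  THIS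
file gives the words «cyclic cubic» their literal meaning: for a Galois extension `E/ℚ` with cyclic
Galois group and ANY intermediate field `F`,

* `F/ℚ` is Galois (`isGalois_intermediateField`: `E/ℚ` is abelian — `IsAbelianGalois.of_isCyclic` —
  and `IsAbelianGalois.tower_bot`) with CYCLIC Galois group of order `[F : ℚ]`
  (`isCyclic_gal_intermediateField`: `Gal(F/ℚ)` is the image of `Gal(E/ℚ)` under the surjective
  `AlgEquiv.restrictNormalHom`; `card_gal_intermediateField`);
* the Galois fundamental identity holds in `F` (`ncard_primesOver_mul`: `#{𝔭 | p}·(e·f) = [F : ℚ]`),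
  so `e ∣ [F : ℚ]` and `f ∣ [F : ℚ]`;
* in a CUBIC `F` every prime `p` is inert (`e = 1, f = 3, g = 1`), splits completely
  (`e = 1, f = 1, g = 3`) or is totally ramified (`e = 3, f = 1, g = 1`) (`cubic_trichotomy`),
  and the unramified case is exactly N2.8.2(b)'s dichotomy (`inert_or_splitsCompletely_of_unramified`,
  through `T5DyadicExamples.inert_or_split_of_unramified`).

Honest scope: which of the three cases occurs for a given `p` (the record's «2 never ramifies»)
is the Kronecker–Weber / conductor input treated in `T5CubicRamification` for subfields of
cyclotomic fields; nothing here identifies `F` with `F⁺`, `K` (that is `T5CyclicSubfields`).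
Uses an L-value-free non-vanishing device: NO (README §8(d)).
-/

namespace Summit.Ventures.HodgeRepro2.T5CyclicSubfieldGalois

open Ideal NumberField

variable (E : Type*) [Field E] [NumberField E] [IsGalois ℚ E] [IsCyclic (E ≃ₐ[ℚ] E)]
  (F : IntermediateField ℚ E)

/-- A Galois extension of `ℚ` with cyclic Galois group is abelian (`IsAbelianGalois.of_isCyclic`). -/
theorem isAbelianGalois : IsAbelianGalois ℚ E :=
  IsAbelianGalois.of_isCyclic ℚ E

/-- Every intermediate field of a cyclic Galois extension of `ℚ` is Galois over `ℚ`. -/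
theorem isGalois_intermediateField : IsGalois ℚ F :=
  haveI := isAbelianGalois E
  (IsAbelianGalois.tower_bot ℚ F E).toIsGalois

/-- Every intermediate field of a cyclic Galois extension of `ℚ` has CYCLIC Galois group:
`Gal(F/ℚ)` is the image of `Gal(E/ℚ)` under restriction (`AlgEquiv.restrictNormalHom_surjective`). -/
theorem isCyclic_gal_intermediateField : IsCyclic (F ≃ₐ[ℚ] F) := by
  haveI : IsGalois ℚ F := isGalois_intermediateField E F
  exact isCyclic_of_surjective (AlgEquiv.restrictNormalHom F)
    (AlgEquiv.restrictNormalHom_surjective E)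

/-- The Galois group of an intermediate field has order `[F : ℚ]`. -/
theorem card_gal_intermediateField : Nat.card (F ≃ₐ[ℚ] F) = Module.finrank ℚ F := by
  haveI : IsGalois ℚ F := isGalois_intermediateField E F
  exact IsGaloisGroup.card_eq_finrank (F ≃ₐ[ℚ] F) ℚ F

/-- «`F⁺` IS the cyclic cubic»: a degree-3 intermediate field of a cyclic Galois extension of `ℚ`
is Galois over `ℚ` with cyclic Galois group of order `3`. -/
theorem isCyclicCubic (hF : Module.finrank ℚ F = 3) :
    IsGalois ℚ F ∧ IsCyclic (F ≃ₐ[ℚ] F) ∧ Nat.card (F ≃ₐ[ℚ] F) = 3 :=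
  ⟨isGalois_intermediateField E F, isCyclic_gal_intermediateField E F,
    (card_gal_intermediateField E F).trans hF⟩

/-- «`K` IS the (imaginary) quadratic subfield», the Galois half: a degree-2 intermediate field
is Galois over `ℚ` with Galois group of order `2`. -/
theorem isGalois_quadratic (hK : Module.finrank ℚ F = 2) :
    IsGalois ℚ F ∧ Nat.card (F ≃ₐ[ℚ] F) = 2 :=
  ⟨isGalois_intermediateField E F, (card_gal_intermediateField E F).trans hK⟩

section Primes

variable (p : ℕ) [Fact p.Prime]

/-- The ideal `(p)` of `ℤ` (maximal: `Int.ideal_span_isMaximal_of_prime`). -/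
local notation3 "𝒑" => (span {(p : ℤ)} : Ideal ℤ)

/-- The Galois fundamental identity in an intermediate field `F`, read off one prime `𝔭` above
`p`: `#{𝔭 | p}·(e·f) = [F : ℚ]`. -/
theorem ncard_primesOver_mul (𝔭 : Ideal (𝓞 F)) [𝔭.IsPrime] [𝔭.LiesOver 𝒑] :
    (𝒑.primesOver (𝓞 F)).ncard * (𝔭.ramificationIdx ℤ * 𝔭.inertiaDeg ℤ) =
      Module.finrank ℚ F := by
  haveI : IsGalois ℚ F := isGalois_intermediateField E F
  rw [← IsGaloisGroup.card_eq_finrank (F ≃ₐ[ℚ] F) ℚ F,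
    ← ncard_primesOver_mul_ramificationIdxIn_mul_inertiaDegIn 𝒑 (𝓞 F) (F ≃ₐ[ℚ] F),
    ramificationIdxIn_eq_ramificationIdx 𝒑 𝔭 (F ≃ₐ[ℚ] F),
    inertiaDegIn_eq_inertiaDeg 𝒑 𝔭 (F ≃ₐ[ℚ] F)]

/-- `e(𝔭|p) ∣ [F : ℚ]`. -/
theorem ramificationIdx_dvd_finrank (𝔭 : Ideal (𝓞 F)) [𝔭.IsPrime] [𝔭.LiesOver 𝒑] :
    𝔭.ramificationIdx ℤ ∣ Module.finrank ℚ F := by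
  refine ⟨(𝒑.primesOver (𝓞 F)).ncard * 𝔭.inertiaDeg ℤ, ?_⟩
  rw [← ncard_primesOver_mul E F p 𝔭]
  ring

/-- `f(𝔭|p) ∣ [F : ℚ]`. -/
theorem inertiaDeg_dvd_finrank (𝔭 : Ideal (𝓞 F)) [𝔭.IsPrime] [𝔭.LiesOver 𝒑] :
    𝔭.inertiaDeg ℤ ∣ Module.finrank ℚ F := by
  refine ⟨(𝒑.primesOver (𝓞 F)).ncard * 𝔭.ramificationIdx ℤ, ?_⟩
  rw [← ncard_primesOver_mul E F p 𝔭]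
  ring

/-- In the cyclic cubic `F`, an UNRAMIFIED prime is inert (`f = 3`, one prime above `p`) or splits
completely (`f = 1`, three primes) — N2.8.2(b)'s dichotomy, from `#{𝔭 | p}·f = 3`. -/
theorem inert_or_splitsCompletely_of_unramified (hF : Module.finrank ℚ F = 3)
    (𝔭 : Ideal (𝓞 F)) [𝔭.IsPrime] [𝔭.LiesOver 𝒑] (he : 𝔭.ramificationIdx ℤ = 1) :
    (𝔭.inertiaDeg ℤ = 3 ∧ (𝒑.primesOver (𝓞 F)).ncard = 1) ∨
      (𝔭.inertiaDeg ℤ = 1 ∧ (𝒑.primesOver (𝓞 F)).ncard = 3) := by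
  have h := ncard_primesOver_mul E F p 𝔭
  rw [hF] at h
  have h3 : 𝔭.ramificationIdx ℤ * 𝔭.inertiaDeg ℤ * (𝒑.primesOver (𝓞 F)).ncard = 3 := by
    rw [← h]; ring
  exact T5DyadicExamples.inert_or_split_of_unramified h3 he

/-- In the cyclic cubic `F`, every prime `p` is inert, splits completely, or is totally ramified:
`(e, f, g) ∈ {(1, 3, 1), (1, 1, 3), (3, 1, 1)}`. -/
theorem cubic_trichotomy (hF : Module.finrank ℚ F = 3) (𝔭 : Ideal (𝓞 F)) [𝔭.IsPrime]
    [𝔭.LiesOver 𝒑] :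
    (𝔭.ramificationIdx ℤ = 1 ∧ 𝔭.inertiaDeg ℤ = 3 ∧ (𝒑.primesOver (𝓞 F)).ncard = 1) ∨
      (𝔭.ramificationIdx ℤ = 1 ∧ 𝔭.inertiaDeg ℤ = 1 ∧ (𝒑.primesOver (𝓞 F)).ncard = 3) ∨
      (𝔭.ramificationIdx ℤ = 3 ∧ 𝔭.inertiaDeg ℤ = 1 ∧ (𝒑.primesOver (𝓞 F)).ncard = 1) := by
  have hd := ramificationIdx_dvd_finrank E F p 𝔭
  rw [hF] at hd
  rcases (Nat.dvd_prime Nat.prime_three).mp hd with he | he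
  · rcases inert_or_splitsCompletely_of_unramified E F p hF 𝔭 he with ⟨hf, hg⟩ | ⟨hf, hg⟩
    · exact Or.inl ⟨he, hf, hg⟩
    · exact Or.inr (Or.inl ⟨he, hf, hg⟩)
  · right; right
    have h := ncard_primesOver_mul E F p 𝔭
    rw [hF, he] at h
    -- `#{𝔭 | p} * (3 * f) = 3` forces `f = 1` and `#{𝔭 | p} = 1`
    have h' : 3 * ((𝒑.primesOver (𝓞 F)).ncard * 𝔭.inertiaDeg ℤ) = 3 * 1 := by
      calc 3 * ((𝒑.primesOver (𝓞 F)).ncard * 𝔭.inertiaDeg ℤ)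
          = (𝒑.primesOver (𝓞 F)).ncard * (3 * 𝔭.inertiaDeg ℤ) := by ring
        _ = 3 := h
        _ = 3 * 1 := by norm_num
    have h1 := Nat.eq_of_mul_eq_mul_left (by norm_num) h'
    exact ⟨he, Nat.eq_one_of_mul_eq_one_left h1, Nat.eq_one_of_mul_eq_one_right h1⟩

end Primes

end Summit.Ventures.HodgeRepro2.T5CyclicSubfieldGalois
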